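import Literature.Analysis.Complex.Bieberbach
import Mathlib.Analysis.SpecialFunctions.Log.Deriv
import HarnessLib

/-!
# The Koebe distortion theorem

Trunk T-STOCH support (complex analysis). For a conformal map `f` of the unit disc (holomorphic
and injective on `𝔻`) and `z ∈ 𝔻`, `r = |z|`:

* `norm_koebe_le_four` (**Pommerenke (1992), Prop. 1.2**, eq. (13)):
  `|(1 - |z|²) f''(z)/f'(z) - 2 z̄| ≤ 4` (Bieberbach's `‖h''(0)‖ ≤ 4‖h'(0)‖`,
  `Literature.Analysis.Complex.AreaThm.norm_deriv_deriv_le_four_mul` of `Literature/Analysis/Complex/Bieberbach.lean`,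
  applied to the Koebe transform `h = f ∘ φ`, `φ(w) = (w + z)/(1 + z̄w)`);
* `norm_deriv_le_distortion`, `distortion_le_norm_deriv` (**Pommerenke Thm. 1.3**, eq. (15)):
  `|f'(0)| (1-r)/(1+r)³ ≤ |f'(z)| ≤ |f'(0)| (1+r)/(1-r)³` (integrate (13) along the radius:
  `d/dt log|f'(tu)| = Re(u f''/f') ∈ [(2t-4)/(1-t²), (2t+4)/(1-t²)]`);
* `norm_sub_le_growth` (**Thm. 1.3**, eq. (14), upper bound):
  `|f(z) - f(0)| ≤ |f'(0)| r/(1-r)²`;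
* `distortion_ball`, `distortion_half_ball`: the same on an arbitrary disc `B(c, R)`, and the
  half-radius constants `12`, `4/27`, `2`.

Mathlib has no univalent-function theory (searched `Koebe`, `distortion`, `Bieberbach`); we USE
`Complex.discMobius` of `Literature/Analysis/Complex/RiemannMapping.lean` for the disc
automorphisms and Mathlib's monotonicity-from-derivative lemmas.

## References

* Ch. Pommerenke, *Boundary Behaviour of Conformal Maps*, Springer (1992), §1.3, Prop. 1.2,
  Thm. 1.3.
* P. L. Duren, *Univalent Functions*, Springer (1983), §2.3, Thm. 2.4–2.6.
-/

noncomputable section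

open Set Filter Metric Topology Complex Real
open scoped ComplexConjugate

namespace Literature.Analysis.Complex

namespace AreaThm

variable {f : ℂ → ℂ}

/-! ### The Koebe transform and Proposition 1.2 -/

/-- The second derivative of the disc automorphism `φ(w) = (w + z)/(1 + z̄ w)` at `0` is
`-2 z̄ (1 - |z|²)` (and the first is `1 - |z|²`, `Complex.deriv_discMobius_zero`). [folklore] -/
theorem hasDerivAt_deriv_discMobius_neg_zero {z : ℂ} (hz : ‖z‖ < 1) :
    HasDerivAt (deriv (discMobius (-z))) (-2 * conj z * (1 - conj z * z)) 0 := by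
  have hz' : ‖-z‖ < 1 := by rwa [norm_neg]
  -- `φ' = (1 - |z|²)/(1 + z̄ w)²` on the disc
  have hev : deriv (discMobius (-z)) =ᶠ[𝓝 0]
      fun w ↦ (1 - conj z * z) / ((1 + conj z * w) * (1 + conj z * w)) := by
    filter_upwards [isOpen_ball.mem_nhds (mem_ball_self (zero_lt_one' ℝ))] with w hw
    have hne := one_sub_conj_mul_ne_zero hz' (mem_ball_zero_iff.1 hw).le
    rw [(hasDerivAt_discMobius hne).deriv, map_neg, pow_two]
    ring
  refine HasDerivAt.congr_of_eventuallyEq ?_ hev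
  have hl : HasDerivAt (fun w : ℂ ↦ 1 + conj z * w) (conj z) 0 := by
    simpa using ((hasDerivAt_id (0 : ℂ)).const_mul (conj z)).const_add 1
  have h1 : HasDerivAt (fun w : ℂ ↦ (1 + conj z * w) * (1 + conj z * w))
      (conj z * (1 + conj z * 0) + (1 + conj z * 0) * conj z) 0 := hl.mul hl
  have h2 := (hasDerivAt_const (0 : ℂ) (1 - conj z * z)).div h1 (by simp)
  refine h2.congr_deriv ?_
  simp
  ring

/-- **Pommerenke (1992), Prop. 1.2** (eq. (13)): for `f` holomorphic and injective on the unit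
disc and `|z| < 1`, `|(1 - |z|²) f''(z)/f'(z) - 2 z̄| ≤ 4`. Proof: Bieberbach's
`‖h''(0)‖ ≤ 4 ‖h'(0)‖` for the Koebe transform `h = f ∘ φ`, `φ(w) = (w + z)/(1 + z̄w)`, where
`h'(0) = (1 - |z|²) f'(z)` and `h''(0) = (1 - |z|²)² f''(z) - 2z̄(1 - |z|²) f'(z)`.
[cite: PommerenkeBBCM1992, Prop. 1.2] -/
theorem norm_koebe_le_four (hf : DifferentiableOn ℂ f (ball 0 1)) (hinj : InjOn f (ball 0 1))
    {z : ℂ} (hz : ‖z‖ < 1) :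
    ‖(1 - ‖z‖ ^ 2) * (deriv (deriv f) z / deriv f z) - 2 * conj z‖ ≤ 4 := by
  have hz' : ‖-z‖ < 1 := by rwa [norm_neg]
  have hzb : z ∈ ball (0 : ℂ) 1 := mem_ball_zero_iff.2 hz
  set φ := discMobius (-z) with hφ
  have hφ0 : φ 0 = z := by simp [hφ]
  have hφm : MapsTo φ (ball 0 1) (ball 0 1) := mapsTo_discMobius hz'
  have hφd : DifferentiableOn ℂ φ (ball 0 1) := differentiableOn_discMobius hz'
  set c : ℂ := 1 - conj z * z with hc
  have hc' : c = 1 - (‖z‖ : ℂ) ^ 2 := by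
    rw [hc, one_sub_conj_mul_self]; push_cast; ring
  have hcpos : (0 : ℝ) < 1 - ‖z‖ ^ 2 := by nlinarith [norm_nonneg z]
  have hc0 : c ≠ 0 := by
    rw [hc', ← Complex.ofReal_pow, ← Complex.ofReal_one, ← Complex.ofReal_sub]
    exact_mod_cast hcpos.ne'
  have hφ'0 : deriv φ 0 = c := by rw [hφ, deriv_discMobius_zero]; simp [hc]
  -- the Koebe transform `h = f ∘ φ`
  set h : ℂ → ℂ := f ∘ φ with hh
  have hhd : DifferentiableOn ℂ h (ball 0 1) := hf.comp hφd hφm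
  have hhinj : InjOn h (ball 0 1) := hinj.comp (injOn_discMobius hz') hφm
  -- `h' = (f' ∘ φ) · φ'` on the disc
  have hderiv : ∀ w ∈ ball (0 : ℂ) 1, deriv h w = deriv f (φ w) * deriv φ w := fun w hw ↦ by
    have hfφ : HasDerivAt f (deriv f (φ w)) (φ w) :=
      (hf.differentiableAt (isOpen_ball.mem_nhds (hφm hw))).hasDerivAt
    have hφw : HasDerivAt φ (deriv φ w) w := (hφd.differentiableAt (isOpen_ball.mem_nhds hw)).hasDerivAt
    exact (hfφ.comp w hφw).deriv
  have h0 : (0 : ℂ) ∈ ball (0 : ℂ) 1 := mem_ball_self one_pos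
  have hh' : deriv h 0 = deriv f z * c := by rw [hderiv 0 h0, hφ0, hφ'0]
  -- `h''(0) = f''(z) c² + f'(z) φ''(0)`
  have hd' : DifferentiableOn ℂ (deriv f) (ball 0 1) := differentiableOn_deriv isOpen_ball hf
  have hh'' : deriv (deriv h) 0 = deriv (deriv f) z * c * c + deriv f z * (-2 * conj z * c) := by
    have hev : deriv h =ᶠ[𝓝 0] fun w ↦ deriv f (φ w) * deriv φ w :=
      Filter.eventuallyEq_of_mem (isOpen_ball.mem_nhds h0) hderiv
    rw [hev.deriv_eq]
    have h1 : HasDerivAt (fun w ↦ deriv f (φ w)) (deriv (deriv f) (φ 0) * deriv φ 0) 0 :=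
      (hd'.differentiableAt (isOpen_ball.mem_nhds (hφm h0))).hasDerivAt.comp 0
        (hφd.differentiableAt (isOpen_ball.mem_nhds h0)).hasDerivAt
    have h2 : HasDerivAt (deriv φ) (-2 * conj z * (1 - conj z * z)) 0 :=
      hasDerivAt_deriv_discMobius_neg_zero hz
    have h3 : HasDerivAt (fun w ↦ deriv f (φ w) * deriv φ w)
        (deriv (deriv f) (φ 0) * deriv φ 0 * deriv φ 0 +
          deriv f (φ 0) * (-2 * conj z * (1 - conj z * z))) 0 := h1.mul h2
    rw [h3.deriv, hφ0, hφ'0]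
  -- Bieberbach for `h`
  have hB := norm_deriv_deriv_le_four_mul hhd hhinj
  rw [hh', hh''] at hB
  have hf'0 : deriv f z ≠ 0 := SCV.deriv_ne_zero_of_injOn hf isOpen_ball hinj hzb
  -- divide by `‖f'(z) c‖`
  have hkey : deriv (deriv f) z * c * c + deriv f z * (-2 * conj z * c) =
      (deriv f z * c) * ((1 - ‖z‖ ^ 2) * (deriv (deriv f) z / deriv f z) - 2 * conj z) := by
    rw [← hc']
    field_simp
    ring
  rw [hkey, norm_mul] at hB
  have hpos : 0 < ‖deriv f z * c‖ := norm_pos_iff.2 (mul_ne_zero hf'0 hc0)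
  rw [mul_comm (4 : ℝ), mul_le_mul_iff_of_pos_left hpos] at hB
  exact hB

/-! ### Distortion along a radius: Theorem 1.3 -/

/-- The radial bound on `Re(u f''/f')` from Prop. 1.2: for `‖u‖ = 1`, `0 ≤ t < 1`, `z = tu`,
`(2t - 4)/(1 - t²) ≤ Re(u f''(z)/f'(z)) ≤ (2t + 4)/(1 - t²)`. [cite: PommerenkeBBCM1992, Prop. 1.2] -/
theorem re_mul_deriv_deriv_div_mem (hf : DifferentiableOn ℂ f (ball 0 1)) (hinj : InjOn f (ball 0 1))
    {u : ℂ} (hu : ‖u‖ = 1) {t : ℝ} (ht0 : 0 ≤ t) (ht1 : t < 1) :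
    (2 * t - 4) / (1 - t ^ 2) ≤ (u * (deriv (deriv f) (t * u) / deriv f (t * u))).re ∧
      (u * (deriv (deriv f) (t * u) / deriv f (t * u))).re ≤ (2 * t + 4) / (1 - t ^ 2) := by
  set z : ℂ := t * u with hz
  have hzn : ‖z‖ = t := by rw [hz, norm_mul, Complex.norm_real, Real.norm_eq_abs, abs_of_nonneg ht0, hu, mul_one]
  have hK := norm_koebe_le_four hf hinj (z := z) (by rw [hzn]; exact ht1)
  rw [hzn] at hK
  set w : ℂ := deriv (deriv f) z / deriv f z with hw
  have ht2 : 0 < 1 - t ^ 2 := by nlinarith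
  -- multiply by the unit `u`: `‖(1-t²) u w - 2t‖ ≤ 4`
  have huu : conj u * u = 1 := by
    rw [conj_mul', ← ofReal_pow, hu]; simp
  have hK' : ‖(1 - t ^ 2 : ℝ) * (u * w) - 2 * t‖ ≤ 4 := by
    have : ((1 - t ^ 2 : ℝ) : ℂ) * (u * w) - 2 * t = u * ((1 - t ^ 2) * w - 2 * conj z) := by
      rw [hz, map_mul, Complex.conj_ofReal]
      push_cast
      linear_combination (2 * (t : ℂ)) * huu
    rw [this, norm_mul, hu, one_mul]
    exact_mod_cast hK
  have hre := (Complex.abs_re_le_norm (((1 - t ^ 2 : ℝ) : ℂ) * (u * w) - 2 * t)).trans hK'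
  rw [sub_re, re_ofReal_mul] at hre
  have h2t : ((2 : ℂ) * t).re = 2 * t := by simp
  rw [h2t] at hre
  obtain ⟨hlo, hhi⟩ := abs_le.1 hre
  constructor
  · rw [div_le_iff₀ ht2]; nlinarith
  · rw [le_div_iff₀ ht2]; nlinarith

/-- The derivative of `t ↦ log ‖F(t)‖` for a nonvanishing differentiable `F : ℝ → ℂ` is
`Re(F'(t)/F(t))`. [folklore] -/
theorem hasDerivAt_log_norm {F : ℝ → ℂ} {F' : ℂ} {t : ℝ} (hF : HasDerivAt F F' t) (hF0 : F t ≠ 0) :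
    HasDerivAt (fun t ↦ Real.log ‖F t‖) ((F' / F t).re) t := by
  have hre : HasDerivAt (fun t ↦ (F t).re) F'.re t := by
    rw [show (fun t ↦ (F t).re) = Complex.reCLM ∘ F from rfl]
    exact (Complex.reCLM.hasFDerivAt.comp_hasDerivAt t hF).congr_deriv (by simp)
  have him : HasDerivAt (fun t ↦ (F t).im) F'.im t := by
    rw [show (fun t ↦ (F t).im) = Complex.imCLM ∘ F from rfl]
    exact (Complex.imCLM.hasFDerivAt.comp_hasDerivAt t hF).congr_deriv (by simp)
  have hN : HasDerivAt (fun t ↦ (F t).re ^ 2 + (F t).im ^ 2)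
      (↑2 * (F t).re ^ (2 - 1) * F'.re + ↑2 * (F t).im ^ (2 - 1) * F'.im) t :=
    (hre.pow 2).add (him.pow 2)
  have hF2 : ∀ s, (F s).re ^ 2 + (F s).im ^ 2 = Complex.normSq (F s) := fun s ↦ by
    rw [Complex.normSq_apply]; ring
  have hN0 : (F t).re ^ 2 + (F t).im ^ 2 ≠ 0 := by
    rw [hF2]; exact (Complex.normSq_pos.2 hF0).ne'
  have hlog := (hN.log hN0).const_mul (1 / 2 : ℝ)
  have heq : (fun t ↦ Real.log ‖F t‖) = fun t ↦ (1 / 2 : ℝ) * Real.log ((F t).re ^ 2 + (F t).im ^ 2) := by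
    funext s
    rw [Complex.norm_eq_sqrt_sq_add_sq, Real.log_sqrt (by positivity)]
    ring
  rw [heq]
  refine hlog.congr_deriv ?_
  -- `Re(F'/F) = (re re' + im im')/(re² + im²)`
  rw [div_re, ← hF2]
  field_simp
  ring

/-- **The logarithmic distortion bounds along a radius**: for `‖u‖ = 1` and `0 ≤ r < 1`,
`log|f'(0)| + log((1-r)/(1+r)³) ≤ log|f'(ru)| ≤ log|f'(0)| + log((1+r)/(1-r)³)` (integrate
`re_mul_deriv_deriv_div_mem`, monotonicity of `t ↦ log|f'(tu)| ∓ (log(1±t) - 3 log(1∓t))`).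
[cite: PommerenkeBBCM1992, Thm. 1.3] -/
theorem log_norm_deriv_bounds (hf : DifferentiableOn ℂ f (ball 0 1)) (hinj : InjOn f (ball 0 1))
    {u : ℂ} (hu : ‖u‖ = 1) {r : ℝ} (hr0 : 0 ≤ r) (hr1 : r < 1) :
    Real.log ‖deriv f (r * u)‖ ≤
        Real.log ‖deriv f 0‖ + (Real.log (1 + r) - 3 * Real.log (1 - r)) ∧
      Real.log ‖deriv f 0‖ + (Real.log (1 - r) - 3 * Real.log (1 + r)) ≤
        Real.log ‖deriv f (r * u)‖ := by
  have hd' : DifferentiableOn ℂ (deriv f) (ball 0 1) := differentiableOn_deriv isOpen_ball hf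
  have hne : ∀ w ∈ ball (0 : ℂ) 1, deriv f w ≠ 0 := fun w hw ↦
    SCV.deriv_ne_zero_of_injOn hf isOpen_ball hinj hw
  have hnorm : ∀ t : ℝ, ‖(t : ℂ) * u‖ = |t| := fun t ↦ by
    rw [norm_mul, Complex.norm_real, Real.norm_eq_abs, hu, mul_one]
  have hmem : ∀ t ∈ Icc 0 r, (t : ℂ) * u ∈ ball (0 : ℂ) 1 := fun t ht ↦ by
    rw [mem_ball_zero_iff, hnorm, abs_of_nonneg ht.1]; exact ht.2.trans_lt hr1
  -- `φ(t) = log |f'(tu)|` and its derivative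
  set φ : ℝ → ℝ := fun t ↦ Real.log ‖deriv f (t * u)‖ with hφ
  have hφ' : ∀ t ∈ Icc 0 r, HasDerivAt φ
      ((u * (deriv (deriv f) (t * u) / deriv f (t * u))).re) t := by
    intro t ht
    have hc : HasDerivAt (fun t : ℝ ↦ (t : ℂ) * u) u t := by
      simpa using ((hasDerivAt_id t).ofReal_comp).mul_const u
    have hF : HasDerivAt (deriv f ∘ fun t : ℝ ↦ (t : ℂ) * u) (deriv (deriv f) (t * u) * u) t :=
      (hd'.differentiableAt (isOpen_ball.mem_nhds (hmem t ht))).hasDerivAt.comp t hc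
    have h := hasDerivAt_log_norm hF (hne _ (hmem t ht))
    refine h.congr_deriv ?_
    simp only [Function.comp_apply]
    congr 1
    ring
  have hφc : ContinuousOn φ (Icc 0 r) := fun t ht ↦ (hφ' t ht).continuousAt.continuousWithinAt
  -- the comparison functions
  have hU' : ∀ t ∈ Icc 0 r, HasDerivAt (fun t ↦ Real.log (1 + t) - 3 * Real.log (1 - t))
      (1 / (1 + t) - 3 * (-1 / (1 - t))) t := fun t ht ↦ by
    have h1 : HasDerivAt (fun t : ℝ ↦ Real.log (1 + t)) (1 / (1 + t)) t :=
      ((hasDerivAt_id' t).const_add 1).log (by linarith [ht.1])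
    have h2 : HasDerivAt (fun t : ℝ ↦ Real.log (1 - t)) (-1 / (1 - t)) t :=
      ((hasDerivAt_id' t).const_sub 1).log (by linarith [ht.2, hr1])
    exact h1.sub (h2.const_mul 3)
  have hL' : ∀ t ∈ Icc 0 r, HasDerivAt (fun t ↦ Real.log (1 - t) - 3 * Real.log (1 + t))
      (-1 / (1 - t) - 3 * (1 / (1 + t))) t := fun t ht ↦ by
    have h1 : HasDerivAt (fun t : ℝ ↦ Real.log (1 + t)) (1 / (1 + t)) t :=
      ((hasDerivAt_id' t).const_add 1).log (by linarith [ht.1])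
    have h2 : HasDerivAt (fun t : ℝ ↦ Real.log (1 - t)) (-1 / (1 - t)) t :=
      ((hasDerivAt_id' t).const_sub 1).log (by linarith [ht.2, hr1])
    exact h2.sub (h1.const_mul 3)
  have hUc : ContinuousOn (fun t ↦ Real.log (1 + t) - 3 * Real.log (1 - t)) (Icc 0 r) :=
    fun t ht ↦ (hU' t ht).continuousAt.continuousWithinAt
  have hLc : ContinuousOn (fun t ↦ Real.log (1 - t) - 3 * Real.log (1 + t)) (Icc 0 r) :=
    fun t ht ↦ (hL' t ht).continuousAt.continuousWithinAt
  have hint : interior (Icc 0 r) = Ioo 0 r := interior_Icc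
  -- upper bound: `φ - U` is decreasing
  have hanti : AntitoneOn (fun t ↦ φ t - (Real.log (1 + t) - 3 * Real.log (1 - t))) (Icc 0 r) := by
    refine antitoneOn_of_hasDerivWithinAt_nonpos (convex_Icc 0 r) (hφc.sub hUc)
      (f' := fun t ↦ (u * (deriv (deriv f) (t * u) / deriv f (t * u))).re -
        (1 / (1 + t) - 3 * (-1 / (1 - t)))) (fun t ht ↦ ?_) (fun t ht ↦ ?_)
    · rw [hint] at ht ⊢
      exact ((hφ' t ⟨ht.1.le, ht.2.le⟩).sub (hU' t ⟨ht.1.le, ht.2.le⟩)).hasDerivWithinAt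
    · rw [hint] at ht
      have hb := (re_mul_deriv_deriv_div_mem hf hinj hu ht.1.le (ht.2.trans hr1)).2
      have ht1 : 1 - t ≠ 0 := by linarith [ht.2, hr1]
      have ht1' : 1 + t ≠ 0 := by linarith [ht.1]
      have ht2 : 1 - t ^ 2 ≠ 0 := by nlinarith [ht.1, ht.2]
      have heq : (2 * t + 4) / (1 - t ^ 2) = 1 / (1 + t) - 3 * (-1 / (1 - t)) := by
        field_simp
        ring
      linarith
  -- lower bound: `φ - L` is increasing
  have hmono : MonotoneOn (fun t ↦ φ t - (Real.log (1 - t) - 3 * Real.log (1 + t))) (Icc 0 r) := by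
    refine monotoneOn_of_hasDerivWithinAt_nonneg (convex_Icc 0 r) (hφc.sub hLc)
      (f' := fun t ↦ (u * (deriv (deriv f) (t * u) / deriv f (t * u))).re -
        (-1 / (1 - t) - 3 * (1 / (1 + t)))) (fun t ht ↦ ?_) (fun t ht ↦ ?_)
    · rw [hint] at ht ⊢
      exact ((hφ' t ⟨ht.1.le, ht.2.le⟩).sub (hL' t ⟨ht.1.le, ht.2.le⟩)).hasDerivWithinAt
    · rw [hint] at ht
      have hb := (re_mul_deriv_deriv_div_mem hf hinj hu ht.1.le (ht.2.trans hr1)).1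
      have ht1 : 1 - t ≠ 0 := by linarith [ht.2, hr1]
      have ht1' : 1 + t ≠ 0 := by linarith [ht.1]
      have ht2 : 1 - t ^ 2 ≠ 0 := by nlinarith [ht.1, ht.2]
      have heq : (2 * t - 4) / (1 - t ^ 2) = -1 / (1 - t) - 3 * (1 / (1 + t)) := by
        field_simp
        ring
      linarith
  have h0r : (0 : ℝ) ∈ Icc 0 r := ⟨le_rfl, hr0⟩
  have hrr : r ∈ Icc 0 r := ⟨hr0, le_rfl⟩
  have hA := hanti h0r hrr hr0
  have hM := hmono h0r hrr hr0
  simp only [hφ, Complex.ofReal_zero, zero_mul, add_zero, sub_zero, Real.log_one,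
    mul_zero] at hA hM
  constructor <;> linarith

/-- **Koebe distortion theorem, upper bound** (Pommerenke (1992), Thm. 1.3, eq. (15)): for `f`
holomorphic and injective on the unit disc and `|z| < 1`,
`|f'(z)| ≤ |f'(0)| (1 + |z|)/(1 - |z|)³`. [cite: PommerenkeBBCM1992, Thm. 1.3] -/
theorem norm_deriv_le_distortion (hf : DifferentiableOn ℂ f (ball 0 1)) (hinj : InjOn f (ball 0 1))
    {z : ℂ} (hz : ‖z‖ < 1) :
    ‖deriv f z‖ ≤ ‖deriv f 0‖ * ((1 + ‖z‖) / (1 - ‖z‖) ^ 3) := by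
  have hne : ∀ w ∈ ball (0 : ℂ) 1, deriv f w ≠ 0 := fun w hw ↦
    SCV.deriv_ne_zero_of_injOn hf isOpen_ball hinj hw
  have h0 : 0 < ‖deriv f 0‖ := norm_pos_iff.2 (hne 0 (mem_ball_self one_pos))
  have hz' : 0 < ‖deriv f z‖ := norm_pos_iff.2 (hne z (mem_ball_zero_iff.2 hz))
  set r : ℝ := ‖z‖ with hr
  have hr0 : 0 ≤ r := norm_nonneg z
  have hr1 : 0 < 1 - r := by linarith
  -- the unit vector
  obtain ⟨u, hu, hzu⟩ : ∃ u : ℂ, ‖u‖ = 1 ∧ z = r * u := by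
    by_cases hz0 : z = 0
    · exact ⟨1, by simp, by simp [hr, hz0]⟩
    · refine ⟨(‖z‖⁻¹ : ℂ) * z, ?_, ?_⟩
      · rw [norm_mul, norm_inv, Complex.norm_real, Real.norm_eq_abs, abs_of_nonneg (norm_nonneg _),
          inv_mul_cancel₀ (norm_ne_zero_iff.2 hz0)]
      · rw [hr, ← mul_assoc, mul_inv_cancel₀ (by exact_mod_cast norm_ne_zero_iff.2 hz0), one_mul]
  have hb := (log_norm_deriv_bounds hf hinj hu (norm_nonneg z) hz).1
  rw [← hzu] at hb
  have hq : 0 < (1 + r) / (1 - r) ^ 3 := by positivity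
  rw [← Real.log_le_log_iff hz' (mul_pos h0 hq), Real.log_mul h0.ne' hq.ne',
    Real.log_div (by linarith) (by positivity), Real.log_pow]
  push_cast
  linarith

/-- **Koebe distortion theorem, lower bound** (Pommerenke (1992), Thm. 1.3, eq. (15)): for `f`
holomorphic and injective on the unit disc and `|z| < 1`,
`|f'(0)| (1 - |z|)/(1 + |z|)³ ≤ |f'(z)|`. [cite: PommerenkeBBCM1992, Thm. 1.3] -/
theorem distortion_le_norm_deriv (hf : DifferentiableOn ℂ f (ball 0 1)) (hinj : InjOn f (ball 0 1))
    {z : ℂ} (hz : ‖z‖ < 1) :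
    ‖deriv f 0‖ * ((1 - ‖z‖) / (1 + ‖z‖) ^ 3) ≤ ‖deriv f z‖ := by
  have hne : ∀ w ∈ ball (0 : ℂ) 1, deriv f w ≠ 0 := fun w hw ↦
    SCV.deriv_ne_zero_of_injOn hf isOpen_ball hinj hw
  have h0 : 0 < ‖deriv f 0‖ := norm_pos_iff.2 (hne 0 (mem_ball_self one_pos))
  have hz' : 0 < ‖deriv f z‖ := norm_pos_iff.2 (hne z (mem_ball_zero_iff.2 hz))
  set r : ℝ := ‖z‖ with hr
  have hr0 : 0 ≤ r := norm_nonneg z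
  have hr1 : 0 < 1 - r := by linarith
  obtain ⟨u, hu, hzu⟩ : ∃ u : ℂ, ‖u‖ = 1 ∧ z = r * u := by
    by_cases hz0 : z = 0
    · exact ⟨1, by simp, by simp [hr, hz0]⟩
    · refine ⟨(‖z‖⁻¹ : ℂ) * z, ?_, ?_⟩
      · rw [norm_mul, norm_inv, Complex.norm_real, Real.norm_eq_abs, abs_of_nonneg (norm_nonneg _),
          inv_mul_cancel₀ (norm_ne_zero_iff.2 hz0)]
      · rw [hr, ← mul_assoc, mul_inv_cancel₀ (by exact_mod_cast norm_ne_zero_iff.2 hz0), one_mul]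
  have hb := (log_norm_deriv_bounds hf hinj hu (norm_nonneg z) hz).2
  rw [← hzu] at hb
  have hq : 0 < (1 - r) / (1 + r) ^ 3 := by positivity
  rw [← Real.log_le_log_iff (mul_pos h0 hq) hz', Real.log_mul h0.ne' hq.ne',
    Real.log_div hr1.ne' (by positivity), Real.log_pow]
  push_cast
  linarith

/-- **Growth theorem, upper bound** (Pommerenke (1992), Thm. 1.3, eq. (14)): for `f`
holomorphic and injective on the unit disc and `|z| < 1`,
`|f(z) - f(0)| ≤ |f'(0)| |z|/(1 - |z|)²` (integrate the distortion bound along the radius).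
[cite: PommerenkeBBCM1992, Thm. 1.3] -/
theorem norm_sub_le_growth (hf : DifferentiableOn ℂ f (ball 0 1)) (hinj : InjOn f (ball 0 1))
    {z : ℂ} (hz : ‖z‖ < 1) :
    ‖f z - f 0‖ ≤ ‖deriv f 0‖ * (‖z‖ / (1 - ‖z‖) ^ 2) := by
  set r : ℝ := ‖z‖ with hr
  have hr0 : 0 ≤ r := norm_nonneg z
  have hr1 : 0 < 1 - r := by linarith
  obtain ⟨u, hu, hzu⟩ : ∃ u : ℂ, ‖u‖ = 1 ∧ z = r * u := by
    by_cases hz0 : z = 0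
    · exact ⟨1, by simp, by simp [hr, hz0]⟩
    · refine ⟨(‖z‖⁻¹ : ℂ) * z, ?_, ?_⟩
      · rw [norm_mul, norm_inv, Complex.norm_real, Real.norm_eq_abs, abs_of_nonneg (norm_nonneg _),
          inv_mul_cancel₀ (norm_ne_zero_iff.2 hz0)]
      · rw [hr, ← mul_assoc, mul_inv_cancel₀ (by exact_mod_cast norm_ne_zero_iff.2 hz0), one_mul]
  have hnorm : ∀ t : ℝ, ‖(t : ℂ) * u‖ = |t| := fun t ↦ by
    rw [norm_mul, Complex.norm_real, Real.norm_eq_abs, hu, mul_one]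
  have hmem : ∀ t ∈ Icc 0 r, (t : ℂ) * u ∈ ball (0 : ℂ) 1 := fun t ht ↦ by
    rw [mem_ball_zero_iff, hnorm, abs_of_nonneg ht.1]; exact ht.2.trans_lt hz
  -- the path `γ(t) = f(tu) - f(0)` and the barrier `B(t) = |f'(0)| t/(1-t)²`
  set γ : ℝ → ℂ := fun t ↦ f (t * u) - f 0 with hγ
  have hγ' : ∀ t ∈ Icc 0 r, HasDerivAt γ (deriv f (t * u) * u) t := fun t ht ↦ by
    have hc : HasDerivAt (fun t : ℝ ↦ (t : ℂ) * u) u t := by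
      simpa using ((hasDerivAt_id t).ofReal_comp).mul_const u
    have h : HasDerivAt (f ∘ fun t : ℝ ↦ (t : ℂ) * u) (deriv f (t * u) * u) t :=
      (hf.differentiableAt (isOpen_ball.mem_nhds (hmem t ht))).hasDerivAt.comp t hc
    exact h.sub_const (f 0)
  set C : ℝ := ‖deriv f 0‖ with hC
  set B : ℝ → ℝ := fun t ↦ C * (t / (1 - t) ^ 2) with hB
  have hB' : ∀ t ∈ Icc 0 r, HasDerivAt B (C * ((1 + t) / (1 - t) ^ 3)) t := fun t ht ↦ by
    have ht1 : (1 - t) ≠ 0 := by linarith [ht.2]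
    have h1 : HasDerivAt (fun t : ℝ ↦ (1 - t) ^ 2) (↑2 * (1 - t) ^ (2 - 1) * (-1)) t :=
      ((hasDerivAt_id' t).const_sub 1).pow 2
    have h2 := ((hasDerivAt_id' t).div h1 (pow_ne_zero 2 ht1)).const_mul C
    refine h2.congr_deriv ?_
    simp only [Nat.add_one_sub_one, pow_one, one_mul]
    field_simp
    ring
  have hbound := image_norm_le_of_norm_deriv_right_le_deriv_boundary' (f := γ)
    (f' := fun t ↦ deriv f (t * u) * u) (a := 0) (b := r) (B := B)
    (B' := fun t ↦ C * ((1 + t) / (1 - t) ^ 3))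
    (fun t ht ↦ (hγ' t ht).continuousAt.continuousWithinAt)
    (fun t ht ↦ (hγ' t ⟨ht.1, ht.2.le⟩).hasDerivWithinAt) (by simp [hγ, hB])
    (fun t ht ↦ (hB' t ht).continuousAt.continuousWithinAt)
    (fun t ht ↦ (hB' t ⟨ht.1, ht.2.le⟩).hasDerivWithinAt)
    (fun t ht ↦ by
      rw [norm_mul, hu, mul_one]
      have h := norm_deriv_le_distortion hf hinj (z := t * u) (by
        rw [hnorm, abs_of_nonneg ht.1]; exact ht.2.trans hz)
      rwa [hnorm, abs_of_nonneg ht.1] at h)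
    (right_mem_Icc.2 hr0)
  simpa [hγ, hB, ← hzu] using hbound

/-! ### Distortion on an arbitrary disc -/

section Disc

variable {c : ℂ} {R : ℝ}

/-- Rescaling a conformal map of `B(c, R)` to the unit disc: `F(ζ) = f(c + Rζ)` is holomorphic
and injective on `𝔻` with `F'(ζ) = R f'(c + Rζ)`. [folklore] -/
theorem rescale_ball (hR : 0 < R) (hf : DifferentiableOn ℂ f (ball c R)) (hinj : InjOn f (ball c R)) :
    DifferentiableOn ℂ (fun ζ ↦ f (c + R * ζ)) (ball 0 1) ∧ InjOn (fun ζ ↦ f (c + R * ζ)) (ball 0 1) ∧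
      ∀ ζ ∈ ball (0 : ℂ) 1, deriv (fun ζ ↦ f (c + R * ζ)) ζ = R * deriv f (c + R * ζ) := by
  have hmaps : MapsTo (fun ζ : ℂ ↦ c + R * ζ) (ball 0 1) (ball c R) := fun ζ hζ ↦ by
    rw [mem_ball_zero_iff] at hζ
    rw [mem_ball, dist_eq_norm, add_sub_cancel_left, norm_mul, Complex.norm_real, Real.norm_eq_abs,
      abs_of_pos hR]
    nlinarith
  have haff : ∀ ζ, HasDerivAt (fun ζ : ℂ ↦ c + R * ζ) R ζ := fun ζ ↦ by
    simpa using ((hasDerivAt_id ζ).const_mul (R : ℂ)).const_add c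
  refine ⟨hf.comp (fun ζ _ ↦ (haff ζ).differentiableAt.differentiableWithinAt) hmaps, ?_, ?_⟩
  · intro ζ₁ h₁ ζ₂ h₂ heq
    have := hinj (hmaps h₁) (hmaps h₂) heq
    have hR0 : (R : ℂ) ≠ 0 := Complex.ofReal_ne_zero.2 hR.ne'
    simpa [hR0] using this
  · intro ζ hζ
    have hfd : HasDerivAt f (deriv f (c + R * ζ)) (c + R * ζ) :=
      (hf.differentiableAt (isOpen_ball.mem_nhds (hmaps hζ))).hasDerivAt
    show deriv (f ∘ fun ζ : ℂ ↦ c + R * ζ) ζ = _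
    rw [(hfd.comp ζ (haff ζ)).deriv, mul_comm]

/-- **Koebe distortion on a disc**: for `f` holomorphic and injective on `B(c, R)` and
`|w - c| < R`, with `ρ = |w - c|/R`,
`|f'(c)| (1-ρ)/(1+ρ)³ ≤ |f'(w)| ≤ |f'(c)| (1+ρ)/(1-ρ)³` and `|f(w) - f(c)| ≤ |f'(c)| R ρ/(1-ρ)²`.
[cite: PommerenkeBBCM1992, Thm. 1.3] -/
theorem distortion_ball (hR : 0 < R) (hf : DifferentiableOn ℂ f (ball c R)) (hinj : InjOn f (ball c R))
    {w : ℂ} (hw : w ∈ ball c R) :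
    ‖deriv f w‖ ≤ ‖deriv f c‖ * ((1 + ‖w - c‖ / R) / (1 - ‖w - c‖ / R) ^ 3) ∧
      ‖deriv f c‖ * ((1 - ‖w - c‖ / R) / (1 + ‖w - c‖ / R) ^ 3) ≤ ‖deriv f w‖ ∧
      ‖f w - f c‖ ≤ ‖deriv f c‖ * R * ((‖w - c‖ / R) / (1 - ‖w - c‖ / R) ^ 2) := by
  obtain ⟨hFd, hFinj, hFderiv⟩ := rescale_ball hR hf hinj
  set ζ : ℂ := ((R : ℂ))⁻¹ * (w - c) with hζ
  have hR0 : (R : ℂ) ≠ 0 := Complex.ofReal_ne_zero.2 hR.ne'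
  have hwζ : c + R * ζ = w := by rw [hζ, ← mul_assoc, mul_inv_cancel₀ hR0]; ring
  have hζn : ‖ζ‖ = ‖w - c‖ / R := by
    rw [hζ, norm_mul, norm_inv, Complex.norm_real, Real.norm_eq_abs, abs_of_pos hR]; ring
  have hζ1 : ‖ζ‖ < 1 := by
    rw [hζn, div_lt_one hR]; rwa [mem_ball, dist_eq_norm] at hw
  have hζb : ζ ∈ ball (0 : ℂ) 1 := mem_ball_zero_iff.2 hζ1
  clear_value ζ
  have h0b : (0 : ℂ) ∈ ball (0 : ℂ) 1 := mem_ball_self one_pos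
  have hF0 : deriv (fun ζ ↦ f (c + R * ζ)) 0 = R * deriv f c := by rw [hFderiv 0 h0b]; simp
  have hFζ : deriv (fun ζ ↦ f (c + R * ζ)) ζ = R * deriv f w := by rw [hFderiv ζ hζb, hwζ]
  have hnR : ‖(R : ℂ)‖ = R := by rw [Complex.norm_real, Real.norm_eq_abs, abs_of_pos hR]
  have h1 := norm_deriv_le_distortion hFd hFinj hζ1
  have h2 := distortion_le_norm_deriv hFd hFinj hζ1
  have h3 := norm_sub_le_growth hFd hFinj hζ1
  rw [hFζ, hF0, hζn, norm_mul, norm_mul, hnR] at h1 h2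
  simp only [hwζ, mul_zero, add_zero, hF0, norm_mul, hnR, hζn] at h3
  have hρ1 : ‖w - c‖ / R < 1 := by rw [← hζn]; exact hζ1
  have hρ0 : 0 ≤ ‖w - c‖ / R := by positivity
  have hq1 : (0:ℝ) ≤ (1 + ‖w - c‖ / R) / (1 - ‖w - c‖ / R) ^ 3 :=
    div_nonneg (by linarith) (pow_nonneg (by linarith) 3)
  have hq2 : (0:ℝ) ≤ (1 - ‖w - c‖ / R) / (1 + ‖w - c‖ / R) ^ 3 :=
    div_nonneg (by linarith) (pow_nonneg (by linarith) 3)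
  refine ⟨?_, ?_, ?_⟩
  · exact le_of_mul_le_mul_left (by linarith [h1]) hR
  · exact le_of_mul_le_mul_left (by linarith [h2]) hR
  · calc ‖f w - f c‖ ≤ R * ‖deriv f c‖ * (‖w - c‖ / R / (1 - ‖w - c‖ / R) ^ 2) := h3
      _ = ‖deriv f c‖ * R * (‖w - c‖ / R / (1 - ‖w - c‖ / R) ^ 2) := by ring

/-- **Koebe distortion at half radius**: for `f` holomorphic and injective on `B(c, R)` and
`|w - c| ≤ R/2`: `|f'(w)| ≤ 12 |f'(c)|`, `(4/27) |f'(c)| ≤ |f'(w)|` and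
`|f(w) - f(c)| ≤ 2 R |f'(c)|` (the constants `(1+½)/(½)³ = 12`, `(½)/(3/2)³ = 4/27`,
`(½)/(½)² = 2`; cf. Lawler (2005), proof of Lemma 4.33: "`|f'(z)| ≤ 12 |f'(0)|` for `|z| ≤ 1/2`").
[cite: PommerenkeBBCM1992, Thm. 1.3] -/
theorem distortion_half_ball (hR : 0 < R) (hf : DifferentiableOn ℂ f (ball c R))
    (hinj : InjOn f (ball c R)) {w : ℂ} (hw : ‖w - c‖ ≤ R / 2) :
    ‖deriv f w‖ ≤ 12 * ‖deriv f c‖ ∧ 4 / 27 * ‖deriv f c‖ ≤ ‖deriv f w‖ ∧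
      ‖f w - f c‖ ≤ 2 * R * ‖deriv f c‖ := by
  have hwb : w ∈ ball c R := by rw [mem_ball, dist_eq_norm]; linarith
  obtain ⟨h1, h2, h3⟩ := distortion_ball hR hf hinj hwb
  set ρ : ℝ := ‖w - c‖ / R with hρ
  have hρ0 : 0 ≤ ρ := by positivity
  have hρ2 : ρ ≤ 1 / 2 := by rw [hρ, div_le_iff₀ hR]; linarith
  have hd : 0 ≤ ‖deriv f c‖ := norm_nonneg _
  refine ⟨?_, ?_, ?_⟩
  · have hq : (1 + ρ) / (1 - ρ) ^ 3 ≤ 12 := by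
      rw [div_le_iff₀ (by nlinarith)]; nlinarith
    calc ‖deriv f w‖ ≤ ‖deriv f c‖ * ((1 + ρ) / (1 - ρ) ^ 3) := h1
      _ ≤ ‖deriv f c‖ * 12 := by gcongr
      _ = 12 * ‖deriv f c‖ := by ring
  · have hq : 4 / 27 ≤ (1 - ρ) / (1 + ρ) ^ 3 := by
      rw [le_div_iff₀ (by positivity)]; nlinarith
    calc 4 / 27 * ‖deriv f c‖ = ‖deriv f c‖ * (4 / 27) := by ring
      _ ≤ ‖deriv f c‖ * ((1 - ρ) / (1 + ρ) ^ 3) := by gcongr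
      _ ≤ ‖deriv f w‖ := h2
  · have hq : ρ / (1 - ρ) ^ 2 ≤ 2 := by
      rw [div_le_iff₀ (by nlinarith)]; nlinarith
    calc ‖f w - f c‖ ≤ ‖deriv f c‖ * R * (ρ / (1 - ρ) ^ 2) := h3
      _ ≤ ‖deriv f c‖ * R * 2 := by gcongr
      _ = 2 * R * ‖deriv f c‖ := by ring

end Disc

end AreaThm

end Literature.Analysis.Complex
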